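import Literature.Analysis.FluidPDE.LeiZhang2017AxisymmetricCriteria
import Summits.NavierStokesRegularity.OSWSelfSimilar.TypeIIInnerLimitCentreLimit
import Summits.NavierStokesRegularity.OSWSelfSimilar.TypeIIInnerLimitGaugeGradient
import Summits.NavierStokesRegularity.NavierStokesRegularity.Theses.CertifiedBlowup
import HarnessLib

/-!
# Witnesses of the crux `CertifiedBlowupAxisymBlowup` (stmt-NavierStokesRegularity-0727): the portrait at the velocity
# scale — inner object, blow-up centre, global vorticity bound — and the crux as equivalent to its strengthening by it

Theorems file landed `--supports stmt-NavierStokesRegularity-0727` (cell `ns-blowup`, GROUP B zone Z1 → the crux's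
«constraints any construction must respect»). A witness of the crux is `(ν, T, u, p)` with `0 < ν`, `0 < T`,
`IsMaximalSmoothSolution ν 0 u p T`, `IsLerayHopfOn T ν 0 (u 0) u`, `HasRapidSpatialDecay (u 0)`, `IsAxisymmetric (u 0)`.
The sibling file `CertifiedBlowupAxisymBlowupSwirlPersists` recorded the Type II and swirl-persistence constraints; the zone-Z1
dictionary (`Summits/NavierStokesRegularity/OSWSelfSimilar/TypeIIInnerLimit*`, parts XXIII–XXXIX, namespace
`Summit.NavierStokesRegularity.OSWSelfSimilar.TypeIIModulationDictionary`) now runs on exactly this witness class. This file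
puts the portrait next to the crux, using only PROVED tree theorems:

* `witness_innerObject_portrait` — for EVERY witness: Type II (`¬ IsTypeIBlowup u T`); the swirl vanishes identically at no
  time before `T`; and the KNSS gauge N-a zoom at the velocity scale: times `tₖ ∈ [T/2, T)`, `tₖ → T`, scales `λₖ > 0 → 0`
  with `(λₖ/ν)‖u‖ ≤ 1` on `[0, tₖ] × ℝ³`, near-max points `xₖ` (`(λₖ/ν)‖u(tₖ, xₖ)‖ → 1`, `‖xₖ − cₖ‖ ≤ Dλₖ`), centres `cₖ`
  bounded and accumulating on the SINGULAR SET ON THE AXIS (every cluster point `x₀` has `¬ IsBoundedNearTop u T x₀` and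
  `cylRadius x₀ = 0`; `cylRadius cₖ → 0`), a GLOBAL vorticity bound `(λₖ²/ν)‖ω(tₖ, x)‖ ≤ 4C` for all `x` and all large `k`
  (KNSS 2009 (4.6) at the window end), and ONE subsequence along which the centres converge to a singular axis point `x⋆`,
  the zoom `y ↦ (λₖ/ν)u(tₖ + (λₖ²/ν)s, cₖ + λₖy)` converges slice-wise locally uniformly to a KNSS blow-up limit `W` (bounded
  smooth ancient mild solution, `|W| ≤ 1 = |W(0,0)|`, with the Oseen identity), the zoomed vorticity converges to `curl W`,
  and EXACTLY ONE of: (α) `W ≡ c`, `‖c‖ = 1`, `c₁ = 0`, zoomed vorticity `→ 0` everywhere (velocity-dominated core); (β) the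
  centres lie on the axis and `W` REFUTES the open conjecture `AxisymmetricLiouvilleBoundedSwirl` (axisymmetric slices,
  `|Γ_W| ≤ Mₛ/ν`, a non-constant slice), carries vorticity and swirl with the physical swirl AND the azimuthal velocity
  concentrating at the velocity scale (`ν⁻¹Γ → Γ_W ≠ 0`, `(λₖ/ν)u_θ → Γ_W/r ≠ 0`), `r‖W_pol‖` and `r‖W_pol − ce_z‖` unbounded,
  `Γ_W ∉ L^∞_sL^q`, `Γ_W` non-decaying and not at the Lei–Ren–Zhang rate;
* `certifiedBlowupAxisymBlowup_iff_exists_innerObject_witness` — the crux is EQUIVALENT to its strengthening by the whole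
  portrait.

The crux-level dichotomy `CertifiedBlowupAxisymBlowup → ¬AxisymmetricLiouvilleBoundedSwirl ∨ (a type-(α) witness)` is
`Summit.NavierStokesRegularity.OSWSelfSimilar.TypeIIModulationDictionary.certifiedBlowupAxisymBlowup_innerObject_dichotomy`.
No new definitions, no named-fact hypotheses, no `sorry`. WHAT THIS IS NOT: not a blow-up or regularity claim — implications
about a hypothetical witness; nothing asserts the crux or (AX-L) or its negation.

## References

* G. Koch, N. Nadirashvili, G. Seregin, V. Šverák, Acta Math. 203 (2009), §4 (4.6), §5 Thms 5.2–5.3, §6 Prop. 6.1 / Lemma 6.1.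
* G. Seregin, V. Šverák, Comm. PDE 34 (2009), §3.
* Z. Lei, Q. S. Zhang, N. Zhao / Z. Lei, X. Ren, Q. S. Zhang (swirl Liouville criteria, as discharged in the tree).
-/

-- the summit and its single problem share the name (D-0017 nested layout)
set_option linter.dupNamespace false

open MeasureTheory Set Function Filter Topology Metric
open scoped ENNReal NNReal

namespace Summit.NavierStokesRegularity.NavierStokesRegularity.Theorems.CertifiedBlowupAxisymBlowup.InnerObject

open Literature.Analysis.FluidPDE
open Summit.NavierStokesRegularity.OSWSelfSimilar.TypeIIModulationDictionary
open Summit.NavierStokesRegularity.NavierStokesRegularity.Theorems.CertifiedBlowupAxisymBlowup.CompactAmplification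

section Witness

variable {ν T : ℝ} {u : ℝ → EuclideanSpace ℝ (Fin 3) → EuclideanSpace ℝ (Fin 3)}
  {p : ℝ → EuclideanSpace ℝ (Fin 3) → ℝ}

/-- **The portrait of a witness of `CertifiedBlowupAxisymBlowup` at the velocity scale** (see the module docstring):
Type II, swirl at every time, and the gauge N-a inner object with its centre on the singular set on the axis, the global
vorticity bound at the gauge times, and the (α)/(β) alternative with every rider (assembly of tree theorems).
[cite: KochNadirashviliSereginSverak2009, §6 Prop. 6.1 and §4 (4.6)] -/
theorem witness_innerObject_portrait (hν : 0 < ν) (hT : 0 < T) (hmax : IsMaximalSmoothSolution ν 0 u p T)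
    (hLH : IsLerayHopfOn T ν 0 (u 0) u) (hdec : HasRapidSpatialDecay (u 0)) (haxi : IsAxisymmetric (u 0)) :
    ¬ IsTypeIBlowup u T ∧ (∀ t ∈ Ico 0 T, ¬ HasNoSwirl (u t)) ∧
    ∃ (Mₛ C : ℝ) (tn lamn : ℕ → ℝ) (cn xn : ℕ → EuclideanSpace ℝ (Fin 3)) (φ : ℕ → ℕ)
      (W : ℝ → EuclideanSpace ℝ (Fin 3) → EuclideanSpace ℝ (Fin 3)) (xstar : EuclideanSpace ℝ (Fin 3)),
      (∀ x, |swirl (u 0) x| ≤ Mₛ) ∧ 0 ≤ C ∧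
      (∀ k, T / 2 ≤ tn k ∧ tn k < T) ∧ Tendsto tn atTop (𝓝 T) ∧ (∀ k, 0 < lamn k) ∧ Tendsto lamn atTop (𝓝 0) ∧
      (∀ k, ∀ t ∈ Icc 0 (tn k), ∀ x, lamn k / ν * ‖u t x‖ ≤ 1) ∧
      Tendsto (fun k => lamn k / ν * ‖u (tn k) (xn k)‖) atTop (𝓝 1) ∧
      (∃ D : ℝ, ∀ k, ‖xn k - cn k‖ ≤ D * lamn k) ∧ (∃ R : ℝ, ∀ k, ‖cn k‖ ≤ R) ∧
      (∀ x₀ : EuclideanSpace ℝ (Fin 3), MapClusterPt x₀ atTop cn → ¬ IsBoundedNearTop u T x₀ ∧ cylRadius x₀ = 0) ∧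
      Tendsto (fun k => cylRadius (cn k)) atTop (𝓝 0) ∧
      (∀ᶠ k in atTop, ∀ x, lamn k ^ 2 / ν * ‖fderiv ℝ (u (tn k)) x‖ ≤ C ∧
        lamn k ^ 2 / ν * ‖curl (u (tn k)) x‖ ≤ 4 * C) ∧
      ¬ IsBoundedNearTop u T xstar ∧ cylRadius xstar = 0 ∧ Tendsto (fun k => cn (φ k)) atTop (𝓝 xstar) ∧
      StrictMono φ ∧ IsKNSSBlowupLimit W ∧
      (∀ s < 0, TendstoLocallyUniformly
        (fun k => ((lamn (φ k) / ν) • stPull (lamn (φ k) ^ 2 / ν) (lamn (φ k)) (tn (φ k)) (cn (φ k)) u) s)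
          (W s) atTop) ∧
      (∀ s t : ℝ, s < t → t < 0 → ∀ x,
        W t x = Literature.Analysis.UnboundedOperators.heatExtension (W s) (t - s) x - oseenDuhamel 1 s W W t x) ∧
      (∀ s < 0, ∀ y : EuclideanSpace ℝ (Fin 3), Tendsto (fun j => (lamn (φ j) ^ 2 / ν) •
        curl (u (tn (φ j) + lamn (φ j) ^ 2 / ν * s)) (cn (φ j) + lamn (φ j) • y)) atTop (𝓝 (curl (W s) y))) ∧
      (((∃ c : EuclideanSpace ℝ (Fin 3), ‖c‖ = 1 ∧ c 1 = 0 ∧ ∀ s < 0, ∀ y : EuclideanSpace ℝ (Fin 3), W s y = c) ∧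
          ∀ s < 0, ∀ y : EuclideanSpace ℝ (Fin 3), Tendsto (fun j => (lamn (φ j) ^ 2 / ν) •
            curl (u (tn (φ j) + lamn (φ j) ^ 2 / ν * s)) (cn (φ j) + lamn (φ j) • y)) atTop (𝓝 0)) ∨
        ((∀ k, cn k 0 = 0 ∧ cn k 1 = 0) ∧
          ¬ Summit.NavierStokesRegularity.NavierStokesRegularity.AxisymmetricLiouvilleBoundedSwirl ∧
          (∀ s < 0, IsAxisymmetric (W s)) ∧ (∀ s < 0, ∀ y : EuclideanSpace ℝ (Fin 3), |swirl (W s) y| ≤ Mₛ / ν) ∧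
          (∃ s < 0, ∃ x : EuclideanSpace ℝ (Fin 3), W s x ≠ W s 0) ∧
          (∃ s < 0, ∃ y : EuclideanSpace ℝ (Fin 3), curl (W s) y ≠ 0) ∧
          (∃ s < 0, ∃ y : EuclideanSpace ℝ (Fin 3), swirl (W s) y ≠ 0 ∧ cylRadius y ≠ 0 ∧
            Tendsto (fun k => ν⁻¹ * swirl (u (tn (φ k) + lamn (φ k) ^ 2 / ν * s)) (cn (φ k) + lamn (φ k) • y)) atTop
              (𝓝 (swirl (W s) y)) ∧
            Tendsto (fun k => ν⁻¹ * (lamn (φ k) *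
              swirlVelocity (u (tn (φ k) + lamn (φ k) ^ 2 / ν * s)) (cn (φ k) + lamn (φ k) • y))) atTop
              (𝓝 (swirl (W s) y / cylRadius y)) ∧ swirl (W s) y / cylRadius y ≠ 0) ∧
          (∀ C' : ℝ, ∃ s < 0, ∃ x : EuclideanSpace ℝ (Fin 3), C' < cylRadius x * ‖poloidalPart (W s) x‖) ∧
          (∀ c C' : ℝ, ∃ s < 0, ∃ x : EuclideanSpace ℝ (Fin 3), C' < cylRadius x * ‖poloidalPart (W s) x - c • eZ‖) ∧
          (∀ q : ℝ≥0∞, 1 ≤ q → q < ⊤ → ∀ K : ℝ≥0, ∃ s < 0, (K : ℝ≥0∞) < eLpNorm (swirl (W s)) q volume) ∧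
          (∃ ε : ℝ, 0 < ε ∧ ∀ R : ℝ, ∃ s < 0, ∃ x : EuclideanSpace ℝ (Fin 3),
            R ≤ cylRadius x ∧ ε < |swirl (W s) x|) ∧
          ∃ ε₀ ∈ Set.Ioo (0 : ℝ) 1, ∀ L R₀ : ℝ, ∃ s < 0, ∃ x : EuclideanSpace ℝ (Fin 3),
            R₀ ≤ cylRadius x ∧ ε₀ * L ^ 2 / cylRadius x < |swirl (W s) x ^ 2 - L ^ 2|)) := by
  refine ⟨not_isTypeIBlowup_of_isMaximalSmoothSolution hν hT hmax hLH hdec haxi,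
    not_hasNoSwirl_slice_of_isMaximalSmoothSolution hν hT hmax hLH hdec haxi, ?_⟩
  obtain ⟨Mₛ, hMₛ⟩ := hdec.abs_swirl_le
  obtain ⟨tn, lamn, cn, xn, φ, W, xstar, htn, htT, hlam, hlam0, hgauge, hnear, hdist, hR, hclus, hcyl, hsing, haxis,
    hlim, hφ, hW, hconv, hmild, hcurl, halt⟩ := innerObject_master_of_datum_centreLimit hν hT hmax hLH hdec haxi hMₛ
  obtain ⟨C, hC, hglob⟩ := eventually_gauge_fderiv_curl_bound_viscosity
  exact ⟨Mₛ, C, tn, lamn, cn, xn, φ, W, xstar, hMₛ, hC, htn, htT, hlam, hlam0, hgauge, hnear, hdist, hR, hclus, hcyl,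
    hglob hν hT hmax hLH htn hlam hlam0 hgauge, hsing, haxis, hlim, hφ, hW, hconv, hmild, hcurl, halt⟩

end Witness

/-- **The crux `CertifiedBlowupAxisymBlowup` is equivalent to its strengthening by the whole velocity-scale portrait**
(Type II, swirl at every time, gauge N-a inner object with centre on the singular set on the axis, global vorticity bound,
(α)/(β) alternative): any construction of an axisymmetric certified blow-up must exhibit all of it.
[cite: KochNadirashviliSereginSverak2009, §6 Prop. 6.1] -/
theorem certifiedBlowupAxisymBlowup_iff_exists_innerObject_witness :
    Summit.NavierStokesRegularity.NavierStokesRegularity.Theses.CertifiedBlowup.CertifiedBlowupAxisymBlowup ↔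
      ∃ ν : ℝ, 0 < ν ∧ ∃ T : ℝ, 0 < T ∧
        ∃ (u : ℝ → EuclideanSpace ℝ (Fin 3) → EuclideanSpace ℝ (Fin 3)) (p : ℝ → EuclideanSpace ℝ (Fin 3) → ℝ),
          IsMaximalSmoothSolution ν 0 u p T ∧ IsLerayHopfOn T ν 0 (u 0) u ∧
            HasRapidSpatialDecay (u 0) ∧ IsAxisymmetric (u 0) ∧
    ¬ IsTypeIBlowup u T ∧ (∀ t ∈ Ico 0 T, ¬ HasNoSwirl (u t)) ∧
    ∃ (Mₛ C : ℝ) (tn lamn : ℕ → ℝ) (cn xn : ℕ → EuclideanSpace ℝ (Fin 3)) (φ : ℕ → ℕ)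
      (W : ℝ → EuclideanSpace ℝ (Fin 3) → EuclideanSpace ℝ (Fin 3)) (xstar : EuclideanSpace ℝ (Fin 3)),
      (∀ x, |swirl (u 0) x| ≤ Mₛ) ∧ 0 ≤ C ∧
      (∀ k, T / 2 ≤ tn k ∧ tn k < T) ∧ Tendsto tn atTop (𝓝 T) ∧ (∀ k, 0 < lamn k) ∧ Tendsto lamn atTop (𝓝 0) ∧
      (∀ k, ∀ t ∈ Icc 0 (tn k), ∀ x, lamn k / ν * ‖u t x‖ ≤ 1) ∧
      Tendsto (fun k => lamn k / ν * ‖u (tn k) (xn k)‖) atTop (𝓝 1) ∧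
      (∃ D : ℝ, ∀ k, ‖xn k - cn k‖ ≤ D * lamn k) ∧ (∃ R : ℝ, ∀ k, ‖cn k‖ ≤ R) ∧
      (∀ x₀ : EuclideanSpace ℝ (Fin 3), MapClusterPt x₀ atTop cn → ¬ IsBoundedNearTop u T x₀ ∧ cylRadius x₀ = 0) ∧
      Tendsto (fun k => cylRadius (cn k)) atTop (𝓝 0) ∧
      (∀ᶠ k in atTop, ∀ x, lamn k ^ 2 / ν * ‖fderiv ℝ (u (tn k)) x‖ ≤ C ∧
        lamn k ^ 2 / ν * ‖curl (u (tn k)) x‖ ≤ 4 * C) ∧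
      ¬ IsBoundedNearTop u T xstar ∧ cylRadius xstar = 0 ∧ Tendsto (fun k => cn (φ k)) atTop (𝓝 xstar) ∧
      StrictMono φ ∧ IsKNSSBlowupLimit W ∧
      (∀ s < 0, TendstoLocallyUniformly
        (fun k => ((lamn (φ k) / ν) • stPull (lamn (φ k) ^ 2 / ν) (lamn (φ k)) (tn (φ k)) (cn (φ k)) u) s)
          (W s) atTop) ∧
      (∀ s t : ℝ, s < t → t < 0 → ∀ x,
        W t x = Literature.Analysis.UnboundedOperators.heatExtension (W s) (t - s) x - oseenDuhamel 1 s W W t x) ∧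
      (∀ s < 0, ∀ y : EuclideanSpace ℝ (Fin 3), Tendsto (fun j => (lamn (φ j) ^ 2 / ν) •
        curl (u (tn (φ j) + lamn (φ j) ^ 2 / ν * s)) (cn (φ j) + lamn (φ j) • y)) atTop (𝓝 (curl (W s) y))) ∧
      (((∃ c : EuclideanSpace ℝ (Fin 3), ‖c‖ = 1 ∧ c 1 = 0 ∧ ∀ s < 0, ∀ y : EuclideanSpace ℝ (Fin 3), W s y = c) ∧
          ∀ s < 0, ∀ y : EuclideanSpace ℝ (Fin 3), Tendsto (fun j => (lamn (φ j) ^ 2 / ν) •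
            curl (u (tn (φ j) + lamn (φ j) ^ 2 / ν * s)) (cn (φ j) + lamn (φ j) • y)) atTop (𝓝 0)) ∨
        ((∀ k, cn k 0 = 0 ∧ cn k 1 = 0) ∧
          ¬ Summit.NavierStokesRegularity.NavierStokesRegularity.AxisymmetricLiouvilleBoundedSwirl ∧
          (∀ s < 0, IsAxisymmetric (W s)) ∧ (∀ s < 0, ∀ y : EuclideanSpace ℝ (Fin 3), |swirl (W s) y| ≤ Mₛ / ν) ∧
          (∃ s < 0, ∃ x : EuclideanSpace ℝ (Fin 3), W s x ≠ W s 0) ∧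
          (∃ s < 0, ∃ y : EuclideanSpace ℝ (Fin 3), curl (W s) y ≠ 0) ∧
          (∃ s < 0, ∃ y : EuclideanSpace ℝ (Fin 3), swirl (W s) y ≠ 0 ∧ cylRadius y ≠ 0 ∧
            Tendsto (fun k => ν⁻¹ * swirl (u (tn (φ k) + lamn (φ k) ^ 2 / ν * s)) (cn (φ k) + lamn (φ k) • y)) atTop
              (𝓝 (swirl (W s) y)) ∧
            Tendsto (fun k => ν⁻¹ * (lamn (φ k) *
              swirlVelocity (u (tn (φ k) + lamn (φ k) ^ 2 / ν * s)) (cn (φ k) + lamn (φ k) • y))) atTop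
              (𝓝 (swirl (W s) y / cylRadius y)) ∧ swirl (W s) y / cylRadius y ≠ 0) ∧
          (∀ C' : ℝ, ∃ s < 0, ∃ x : EuclideanSpace ℝ (Fin 3), C' < cylRadius x * ‖poloidalPart (W s) x‖) ∧
          (∀ c C' : ℝ, ∃ s < 0, ∃ x : EuclideanSpace ℝ (Fin 3), C' < cylRadius x * ‖poloidalPart (W s) x - c • eZ‖) ∧
          (∀ q : ℝ≥0∞, 1 ≤ q → q < ⊤ → ∀ K : ℝ≥0, ∃ s < 0, (K : ℝ≥0∞) < eLpNorm (swirl (W s)) q volume) ∧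
          (∃ ε : ℝ, 0 < ε ∧ ∀ R : ℝ, ∃ s < 0, ∃ x : EuclideanSpace ℝ (Fin 3),
            R ≤ cylRadius x ∧ ε < |swirl (W s) x|) ∧
          ∃ ε₀ ∈ Set.Ioo (0 : ℝ) 1, ∀ L R₀ : ℝ, ∃ s < 0, ∃ x : EuclideanSpace ℝ (Fin 3),
            R₀ ≤ cylRadius x ∧ ε₀ * L ^ 2 / cylRadius x < |swirl (W s) x ^ 2 - L ^ 2|)) := by
  constructor
  · rintro ⟨ν, hν, T, hT, u, p, hmax, hLH, hdec, haxi⟩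
    exact ⟨ν, hν, T, hT, u, p, hmax, hLH, hdec, haxi, witness_innerObject_portrait hν hT hmax hLH hdec haxi⟩
  · rintro ⟨ν, hν, T, hT, u, p, hmax, hLH, hdec, haxi, -⟩
    exact ⟨ν, hν, T, hT, u, p, hmax, hLH, hdec, haxi⟩

end Summit.NavierStokesRegularity.NavierStokesRegularity.Theorems.CertifiedBlowupAxisymBlowup.InnerObject
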